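import Literature.AlgebraicGeometry.Resolution.StrictNormalCrossingsFibre
import Literature.AlgebraicGeometry.Resolution.StrictTransformBaseChange
import Literature.AlgebraicGeometry.Resolution.BlowupSequencesBaseChange
import Literature.AlgebraicGeometry.Resolution.BlowupSNC
import HarnessLib

/-!
# Model data for a multiple blow-up over a base, and resolutions in the fibres

Topic: `Literature/AlgebraicGeometry/Resolution`. The fibre half of the spreading-out argument
for `SpreadsShapedFromGenericPoint` (`CanonicalResolutionSpread.lean`; BGMW 2011, Def. 3.1.3,
Thm. 8.0.5 with Cor. 8.0.6–8.0.7; EGA IV₃ §8–§9 technique). A multiple blow-up `s`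
(`CentreSeq`) of a scheme `q : X → Spec A`, together with an ideal sheaf `𝓘` and a boundary `E`,
carries **model data** (`CentreSeq.ModelData q s 𝓘 E`, a recursive predicate) when, at every
stage, the obligations produced by spreading out hold GLOBALLY on the model:

* `𝓘 ⊆ C` for the centre `C` (BGMW Lemma 3.2.1 with `μ = 1`);
* for all finite sets `B, T` of members of `E`, the saturated stratum
  `V(satCentre C B ⊔ ∑_{K∈T} K)` (`SncSaturatedCentre.lean`) is SMOOTH over `Spec A`, and every
  `D₀ ∈ B ∖ T` in `E` restricts to an effective Cartier divisor on it with smooth zero scheme;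
* the exceptional divisor of the blow-up along `C` is smooth over `Spec A`;
* for every `K ∈ E`, the strict transform `V(σᶜ(K))` is smooth over `Spec A` and the exceptional
  divisor restricts to an effective Cartier divisor on it, with smooth zero scheme;
* recursively for the rest of the sequence w.r.t. the controlled transform `(π^*𝓘 : 𝓘(D))` and
  the transformed boundary `σᶜ(E) ∪ {D}`; at the end, `𝓘 = 𝒪`.

**Theorem** (`CentreSeq.ModelData.isResolutionOf_comap`). If `s` carries model data then for
every field-valued point of `Spec A` with fibre `ι : X_k → X` (any cartesian square) on which the
pulled-back boundary `ι^*E` has simple normal crossings, the induced sequence `s^*ι`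
(`CentreSeq.comap`) is a RESOLUTION (BGMW Def. 3.1.3, `CentreSeq.IsResolutionOf`) of the marked
ideal `(X_k, ι^*𝓘, ι^*E, 1)`. One step: the centre `ι^*C` is admissible — support from `𝓘 ⊆ C`,
simple normal crossings with `ι^*E` from the smooth saturated strata
(`hasSNCWith_comap_of_smooth_satCentre`, `StrictNormalCrossingsFibre.lean`), regular since snc;
the blow-up of `X_k` along it is the fibre of the blow-up of `X` (exceptional divisor flat,
`BlowupSequencesBaseChange.lean`), on which the transform of the marked ideal specializes
(`MarkedIdeal.transform_comap_of_prime_stalks`, `StrictTransformBaseChange.lean`: the strict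
transforms have regular fibres and meet the exceptional divisor in relative Cartier divisors)
and the boundary keeps simple normal crossings (`HasSNCWith.hasSNC_transform`, `BlowupSNC.lean`),
so the induction proceeds.

## Sources

* E. Bierstone, D. Grigoriev, P. Milman, J. Włodarczyk, arXiv:1206.3090, Def. 3.1.3,
  Lemma 3.2.1, Thm. 8.0.5, Cor. 8.0.6–8.0.7. [BierstoneGrigorievMilmanWlodarczyk2011]
* A. Grothendieck, J. Dieudonné, EGA IV₃ (1966) §8–§9, IV₄ (1967) §17 (spreading out).
  [folklore]
* The Stacks Project, Tags 056P, 056S, 0805. [StacksProject]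
-/

noncomputable section

open CategoryTheory CategoryTheory.Limits AlgebraicGeometry TopologicalSpace

namespace Literature.AlgebraicGeometry.Resolution

universe u

open Scheme.IdealSheafData

namespace CentreSeq

variable {A : Type u} [CommRing A]

/-- **Model data for a multiple blow-up over `Spec A`** (the global obligations of the
spreading-out argument, see the module docstring): `𝓘 ⊆ C`; smooth saturated strata of `(E, C)`
with relative Cartier restrictions of the members of `E` and smooth zero schemes; smooth
exceptional divisor; smooth strict transforms of the members of `E` meeting the exceptional
divisor in relative Cartier divisors with smooth zero schemes; recursively for the rest w.r.t.
the controlled transform of `𝓘` and the transformed boundary; `𝓘 = 𝒪` at the end.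
[cite: BierstoneGrigorievMilmanWlodarczyk2011, Def. 3.1.3 with Lemma 3.2.1] -/
def ModelData : {X : Scheme.{u}} → (X ⟶ Spec (.of A)) → CentreSeq X → X.IdealSheafData →
    List X.IdealSheafData → Prop
  | _, _, nil _, 𝓘, _ => 𝓘 = ⊤
  | X, q, cons C rest, 𝓘, E =>
      𝓘 ≤ C ∧
      (∀ B T : Finset X.IdealSheafData, (∀ K ∈ B, K ∈ E) → (∀ K ∈ T, K ∈ E) →
        Smooth ((satCentre C B ⊔ T.sup id).subschemeι ≫ q)) ∧
      (∀ B T : Finset X.IdealSheafData, (∀ K ∈ B, K ∈ E) → (∀ K ∈ T, K ∈ E) →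
        ∀ D₀ ∈ E, D₀ ∈ B → D₀ ∉ T →
          IsEffectiveCartier (D₀.comap (satCentre C B ⊔ T.sup id).subschemeι) ∧
          Smooth ((D₀.comap (satCentre C B ⊔ T.sup id).subschemeι).subschemeι ≫
            (satCentre C B ⊔ T.sup id).subschemeι ≫ q)) ∧
      Smooth ((C.comap (blowup.π C)).subschemeι ≫ blowup.π C ≫ q) ∧
      (∀ K ∈ E,
        Smooth ((strictTransformIdeal (blowup.π C) C K).subschemeι ≫ blowup.π C ≫ q) ∧
        IsEffectiveCartier ((C.comap (blowup.π C)).comap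
          (strictTransformIdeal (blowup.π C) C K).subschemeι) ∧
        Smooth ((((C.comap (blowup.π C)).comap
          (strictTransformIdeal (blowup.π C) C K).subschemeι)).subschemeι ≫
            (strictTransformIdeal (blowup.π C) C K).subschemeι ≫ blowup.π C ≫ q)) ∧
      ModelData (blowup.π C ≫ q) rest (controlledTransform (blowup.π C) C 𝓘 1)
        (E.map (strictTransformIdeal (blowup.π C) C) ++ [C.comap (blowup.π C)])

/-- Unfolding. [folklore] -/
@[simp] theorem modelData_nil {X : Scheme.{u}} (q : X ⟶ Spec (.of A)) (𝓘 : X.IdealSheafData)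
    (E : List X.IdealSheafData) : ModelData q (nil X) 𝓘 E ↔ 𝓘 = ⊤ := Iff.rfl

/-- A one-step sequence is a resolution of `M` iff its centre is admissible and the rest resolves
the transform. [folklore] -/
theorem cons_isResolutionOf_iff {X : Scheme.{u}} (C : X.IdealSheafData) (rest : CentreSeq (blowup C))
    (M : MarkedIdeal X) :
    (cons C rest).IsResolutionOf M ↔ (C.support : Set X) ⊆ M.support ∧ HasSNCWith M.boundary C ∧
      Scheme.IsRegular C.subscheme ∧ rest.IsResolutionOf (M.transform (blowup.π C) C) := by
  simp only [IsResolutionOf, isAdmissibleFor_cons, transformMarked_cons]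
  tauto

variable {k : Type u} [Field k] [Algebra A k]

/-- **A multiple blow-up with model data specializes to a resolution in every fibre on which the
boundary keeps simple normal crossings** (see the module docstring).
[cite: BierstoneGrigorievMilmanWlodarczyk2011, Def. 3.1.3 with Lemma 3.2.1 and Thm. 8.0.5] -/
theorem ModelData.isResolutionOf_comap :
    ∀ {X : Scheme.{u}} [IsLocallyNoetherian X] (s : CentreSeq X) (q : X ⟶ Spec (.of A))
      (𝓘 : X.IdealSheafData) (E : List X.IdealSheafData), ModelData q s 𝓘 E →
      ∀ {Xk : Scheme.{u}} [IsLocallyNoetherian Xk] (ι : Xk ⟶ X) (sk : Xk ⟶ Spec (.of k)),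
        IsPullback ι sk q (specOfAlgebra A k) → HasSNC (E.map fun K => K.comap ι) →
        (s.comap ι).IsResolutionOf ⟨𝓘.comap ι, E.map fun K => K.comap ι, 1⟩
  | X, _, nil _, q, 𝓘, E, h, Xk, _, ι, sk, _, _ => by
    have h𝓘 : 𝓘 = ⊤ := h
    refine (isResolutionOf_nil_iff _).mpr ?_
    rw [MarkedIdeal.support_of_mult_eq_one _ rfl]
    change (((𝓘.comap ι).support : Closeds Xk) : Set Xk) = ∅
    rw [h𝓘, comap_top, support_top]
    rfl
  | X, _, cons C rest, q, 𝓘, E, h, Xk, _, ι, sk, HX, hEk => by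
    obtain ⟨hIC, hsm, hcart, hexc, hbd, hrest⟩ := h
    haveI : IsProper (blowup.π C) := (blowup.isBlowup C).isProper
    haveI : IsProper (blowup.π (C.comap ι)) := (blowup.isBlowup (C.comap ι)).isProper
    haveI : IsLocallyNoetherian (blowup C) := LocallyOfFiniteType.isLocallyNoetherian (blowup.π C)
    haveI : IsLocallyNoetherian (blowup (C.comap ι)) :=
      LocallyOfFiniteType.isLocallyNoetherian (blowup.π (C.comap ι))
    -- the marked ideals
    set M : MarkedIdeal X := ⟨𝓘, E, 1⟩ with hM
    have hMk : (⟨𝓘.comap ι, E.map fun K => K.comap ι, 1⟩ : MarkedIdeal Xk) = M.comap ι := rfl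
    -- ### the centre `ι^*C` is admissible
    have hsnck : HasSNCWith (E.map fun K => K.comap ι) (C.comap ι) :=
      hasSNCWith_comap_of_smooth_satCentre k q HX E C hEk hsm
        fun B T hB hT D₀ hD₀E hD₀B hD₀T => by
          obtain ⟨hc, hs⟩ := hcart B T hB hT D₀ hD₀E hD₀B hD₀T
          haveI := hs
          exact ⟨hc, inferInstance⟩
    have hregk : Scheme.IsRegular (C.comap ι).subscheme := hsnck.isRegular_subscheme
    have hsuppk : ((C.comap ι).support : Set Xk) ⊆ (M.comap ι).support := by
      rw [MarkedIdeal.support_of_mult_eq_one _ rfl]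
      exact support_antitone (comap_mono ι hIC)
    -- ### the blown-up fibre is the fibre of the blow-up
    haveI hexcFlat : Flat ((C.comap (blowup.π C)).subschemeι ≫ blowup.π C ≫ q) := by
      haveI := hexc
      infer_instance
    have HX₁ : IsPullback (blowup.comapMap C ι) (blowup.π (C.comap ι) ≫ sk) (blowup.π C ≫ q)
        (specOfAlgebra A k) :=
      blowup.isPullback_comapMap_specMap_of_flat_exceptional k q C HX
    have hsq : blowup.comapMap C ι ≫ blowup.π C = blowup.π (C.comap ι) ≫ ι := blowup.comapMap_π C ι
    -- ### the transform specializes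
    have hD : IsEffectiveCartier (C.comap (blowup.π C)) := (blowup.isBlowup C).isEffectiveCartier
    have hle : M.ideal.comap (blowup.π C) ≤ C.comap (blowup.π C) ^ M.mult := by
      rw [hM, pow_one]
      exact comap_mono _ hIC
    have hDs : IsEffectiveCartier ((C.comap (blowup.π C)).comap (blowup.comapMap C ι)) :=
      hD.comap_fst_of_flat_subschemeι k (blowup.π C ≫ q) HX₁
    have htr : (M.comap ι).transform (blowup.π (C.comap ι)) (C.comap ι) =
        (M.transform (blowup.π C) C).comap (blowup.comapMap C ι) := by
      refine MarkedIdeal.transform_comap_of_prime_stalks ι hsq M C hD hle hDs fun K hK z hz => ?_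
      obtain ⟨hsmK, hcartK, hzsK⟩ := hbd K hK
      haveI := hsmK
      haveI : Flat ((((C.comap (blowup.π C)).comap
          (strictTransformIdeal (blowup.π C) C K).subschemeι)).subschemeι ≫
            (strictTransformIdeal (blowup.π C) C K).subschemeι ≫ blowup.π C ≫ q) := by
        haveI := hzsK
        infer_instance
      refine ⟨isPrime_stalkIdeal_of_isRegular_subscheme
        (isRegular_subscheme_comap_of_smooth (blowup.π C ≫ q) _ HX₁) hz, ?_⟩
      exact not_stalkIdeal_le_of_isEffectiveCartier_comap_subschemeι
        (isEffectiveCartier_comap_comap_subschemeι k (blowup.π C ≫ q) _ _ hcartK HX₁) hz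
    -- ### the new boundary keeps simple normal crossings in the fibre
    have hEk₁ : HasSNC ((E.map (strictTransformIdeal (blowup.π C) C) ++ [C.comap (blowup.π C)]).map
        fun K => K.comap (blowup.comapMap C ι)) := by
      have hb := congrArg MarkedIdeal.boundary htr
      simp only [MarkedIdeal.transform_boundary, MarkedIdeal.comap_boundary, hM] at hb
      have h2 := hsnck.hasSNC_transform (blowup.isBlowup (C.comap ι))
      rw [hb] at h2
      exact h2
    -- ### induction
    have ih := ModelData.isResolutionOf_comap rest (blowup.π C ≫ q)
      (controlledTransform (blowup.π C) C 𝓘 1)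
      (E.map (strictTransformIdeal (blowup.π C) C) ++ [C.comap (blowup.π C)]) hrest
      (blowup.comapMap C ι) (blowup.π (C.comap ι) ≫ sk) HX₁ hEk₁
    have hM₁ : (⟨(controlledTransform (blowup.π C) C 𝓘 1).comap (blowup.comapMap C ι),
        (E.map (strictTransformIdeal (blowup.π C) C) ++ [C.comap (blowup.π C)]).map
          fun K => K.comap (blowup.comapMap C ι), 1⟩ : MarkedIdeal (blowup (C.comap ι))) =
        (M.comap ι).transform (blowup.π (C.comap ι)) (C.comap ι) := by
      rw [htr]
      rfl
    rw [hM₁] at ih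
    -- ### conclusion
    show (cons (C.comap ι) (rest.comap (blowup.comapMap C ι))).IsResolutionOf (M.comap ι)
    exact (cons_isResolutionOf_iff _ _ _).mpr ⟨hsuppk, hsnck, hregk, ih⟩

end CentreSeq

end Literature.AlgebraicGeometry.Resolution

end
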